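import Mathlib
import HarnessLib
import Literature.MathematicalPhysics.StatisticalMechanics.TorusPolymerTranslations
import Literature.MathematicalPhysics.StatisticalMechanics.BlockNeighbourhoodBox
import Literature.MathematicalPhysics.StatisticalMechanics.ReblockingCounting

/-!
# A set of sup-diameter `< s` meets at most `2^d` blocks of side `s` (the sharp count behind
# Brydges' Lemma 6.15 / [ABKM19] App. A, Lemma A.1)

On the odd torus `(ℤ/M)^d`, `M = s·t` with `s, t` odd and `t ≠ 3`, paved by the centred blocks of
side `s` of [AKM16]/[ABKM19] (`TorusPolymer.blockOf`): a set `Y` whose points are pairwise at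
sup-distance `≤ s − 1` meets at most `2^d` blocks of side `s` (`card_blocks_le_two_pow_of_supNorm_sub_le`).
This is the geometric input of the closure gain `|X|_k ≥ η |X̄|_{k+1}` for large connected polymers
(Brydges 2009, Lemma 6.15, first claim of the proof: "any set of `2^d + 1` `(j+1)`-blocks contains a
pair of blocks that do not touch … so that `b₁ ∪ b₂ ⊂ X` is not possible"): a connected union of
`2^d + 1` blocks of side `s` has sup-diameter `≤ (2^d+1)s − 1 < L s` and therefore meets at most `2^d`
blocks of side `L s`, two of its blocks lying in a common coarse block.  The volume count
`card_blocks_le_of_subset_ball` of `ReblockingCounting` only gives `4^d` here; the sharp `2^d` is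
needed because the gain is claimed for every connected polymer with more than `2^d` blocks.

Proof: translate by the block lattice so that the block of a point `y₀ ∈ Y` is the central block;
then every coordinate of every point of `Y` has symmetric representative of size `≤ 3h`
(`s = 2h+1`), so every block index lies in `{−1, 0, 1}`, and on no axis do both `−1` and `+1` occur
(two such points would be `≥ s + 1` apart along that axis; this is where `t ≥ 5` is used — for
`t = 3` the three blocks of an axis are pairwise cyclic neighbours and the index bookkeeping below
does not see the arc structure; `t = 1` is a single block).  Hence the index vectors of `Y` lie in a
product of `d` two-element sets.

## References
* D. C. Brydges, *Lectures on the renormalisation group*, IAS/Park City Math. Ser. 16 (2009),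
  Lemma 6.15 and its proof, p. 73 [Brydges2009].
* S. Adams, S. Buchholz, R. Kotecký, S. Müller, arXiv:1910.13564, App. A, Lemma A.1 (uses
  [Bry09, Lemma 6.15]); Ch. 6.2 (the paving, (6.25)–(6.27)) [AdamsBuchholzKoteckyMuller2019].
-/

noncomputable section

namespace Literature.MathematicalPhysics.StatisticalMechanics.TorusPolymer

open scoped BigOperators Classical
open Finset

variable {d M : ℕ}

/-! ## One coordinate: indices near the central block -/

/-- A residue with symmetric representative of size `≤ h + (s − 1) = 3h` (`s = 2h + 1`) has block
index in `{−1, 0, 1}`. [cite: Brydges2009, Lemma 6.15 (proof, first claim)] -/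
theorem abs_resIndex_le_one_of_natAbs_le {s : ℕ} (hs : Odd s) {v : ZMod M}
    (hv : v.valMinAbs.natAbs ≤ (s - 1) / 2 + (s - 1)) : |resIndex s v| ≤ 1 := by
  have hspec := (resIndex_eq_iff hs v (resIndex s v)).1 rfl
  obtain ⟨h, rfl⟩ := hs
  have hh : (((2 * h + 1 : ℕ) : ℤ) - 1) / 2 = h := by push_cast; omega
  have hh' : (2 * h + 1 - 1) / 2 + (2 * h + 1 - 1) = 3 * h := by omega
  rw [hh] at hspec
  rw [hh'] at hv
  set b := resIndex (2 * h + 1) v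
  push_cast at hspec
  have hv1 : v.valMinAbs ≤ 3 * (h : ℤ) := by omega
  have hv2 : -(3 * (h : ℤ)) ≤ v.valMinAbs := by omega
  rw [abs_le]
  constructor
  · by_contra hcon
    have hb : b ≤ -2 := by omega
    nlinarith
  · by_contra hcon
    have hb : 2 ≤ b := by omega
    nlinarith

/-- Index `1` forces the representative to be `≥ h + 1`, index `−1` forces it to be `≤ −(h+1)`
(`s = 2h+1`). [cite: Brydges2009, Lemma 6.15 (proof, first claim)] -/
theorem valMinAbs_bounds_of_resIndex_eq {s : ℕ} (hs : Odd s) (v : ZMod M) :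
    (resIndex s v = 1 → ((s : ℤ) + 1) / 2 ≤ v.valMinAbs ∧ v.valMinAbs ≤ (3 * (s : ℤ) - 1) / 2) ∧
    (resIndex s v = -1 → v.valMinAbs ≤ -(((s : ℤ) + 1) / 2) ∧ -((3 * (s : ℤ) - 1) / 2) ≤ v.valMinAbs) := by
  obtain ⟨h, rfl⟩ := hs
  have hh : (((2 * h + 1 : ℕ) : ℤ) - 1) / 2 = h := by push_cast; omega
  have e1 : (((2 * h + 1 : ℕ) : ℤ) + 1) / 2 = h + 1 := by push_cast; omega
  have e2 : (3 * ((2 * h + 1 : ℕ) : ℤ) - 1) / 2 = 3 * h + 1 := by push_cast; omega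
  rw [e1, e2]
  constructor
  · intro h1
    have hspec := (resIndex_eq_iff ⟨h, rfl⟩ v 1).1 h1
    rw [hh] at hspec
    push_cast at hspec
    constructor <;> linarith
  · intro h1
    have hspec := (resIndex_eq_iff ⟨h, rfl⟩ v (-1)).1 h1
    rw [hh] at hspec
    push_cast at hspec
    constructor <;> linarith

/-! ## The sharp block count -/

/-- The block centre is a vector of the block lattice `(sℤ)^d` (so `−c(B)` is an admissible
translation). [cite: AdamsBuchholzKoteckyMuller2019, Ch. 6.2] -/
theorem isLatticeVec_neg_blockCenter [NeZero M] (s : ℕ) (x : Fin d → ZMod M) :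
    IsLatticeVec s (-blockCenter s x) := by
  intro i
  refine ⟨-cubeIndex s x i, ?_⟩
  simp only [Pi.neg_apply, blockCenter]
  push_cast
  ring

/-- **A set of sup-diameter `≤ s − 1` meets at most `2^d` blocks of side `s`** on the odd torus
`M = s·t`, `t ≠ 3` (for `t = 3` the statement is still true but the three blocks of an axis are
pairwise cyclic neighbours; the renormalisation-group tori `M = L^N`, `s = L^{k+1}`, `L ≥ 5` never
have `t = 3`).  This is the first claim in the proof of Brydges' Lemma 6.15 ("any set of `2^d+1`
blocks contains a pair of blocks that do not touch, therefore … `b₁ ∪ b₂ ⊂ X` is not possible"),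
in counted form. [cite: Brydges2009, Lemma 6.15 (proof, first claim)] -/
theorem card_blocks_le_two_pow_of_supNorm_sub_le [NeZero M] {s t : ℕ} (hM : M = s * t) (hs : Odd s)
    (ht : Odd t) (ht3 : t ≠ 3) {Y : Finset (Fin d → ZMod M)}
    (hY : ∀ y ∈ Y, ∀ y' ∈ Y, GradientFRD.supNorm (y - y') ≤ s - 1) :
    (blocks s Y).card ≤ 2 ^ d := by
  rcases Y.eq_empty_or_nonempty with rfl | ⟨y₀, hy₀⟩
  · simp
  have ht1 : t = 1 ∨ 5 ≤ t := by obtain ⟨k, rfl⟩ := ht; omega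
  rcases ht1 with rfl | ht5
  · -- `t = 1`: a single block
    rw [card_blocks_eq_numBlocks, numBlocks]
    calc (Y.image fun x => fun i => cubeIndex s x i).card
        ≤ ({fun _ => (0 : ℤ)} : Finset (Fin d → ℤ)).card := by
          refine card_le_card fun b hb => ?_
          obtain ⟨y, -, rfl⟩ := mem_image.1 hb
          rw [mem_singleton]
          funext i
          have := abs_resIndex_le hM hs (by decide : Odd 1) (y i)
          rw [cubeIndex_eq_resIndex]
          simpa using this
      _ = 1 := card_singleton _
      _ ≤ 2 ^ d := Nat.one_le_two_pow
  · -- `t ≥ 5`: translate the block of `y₀` to the centre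
    obtain ⟨h, rfl⟩ := hs
    have hsodd : Odd (2 * h + 1) := ⟨h, rfl⟩
    set c₀ := blockCenter (2 * h + 1) y₀ with hc₀
    set Y' := translate (-c₀) Y with hY'
    have hcard : (blocks (2 * h + 1) Y).card = (blocks (2 * h + 1) Y').card :=
      (card_blocks_translate hM hsodd ht (isLatticeVec_neg_blockCenter _ y₀) Y).symm
    rw [hcard, card_blocks_eq_numBlocks, numBlocks]
    -- elements of `Y'` are `y − c₀`, `y ∈ Y`
    have hmem : ∀ y' ∈ Y', ∃ y ∈ Y, y' = y - c₀ := by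
      intro y' hy'
      refine ⟨y' - -c₀, mem_translate.1 hy', ?_⟩
      abel
    -- coordinates of `y − c₀` are small
    have hcoord : ∀ y ∈ Y, ∀ i, ((y - c₀) i).valMinAbs.natAbs ≤ (2 * h + 1 - 1) / 2 + (2 * h + 1 - 1) := by
      intro y hy i
      have h1 : GradientFRD.supNorm (y₀ - c₀) ≤ (2 * h + 1 - 1) / 2 :=
        (mem_blockOf_iff_supNorm_sub_blockCenter_le hM hsodd ht y₀ y₀).1 (mem_blockOf_self _ y₀)
      have h2 := hY y hy y₀ hy₀
      have h3 := supNorm_sub_le y y₀ c₀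
      have h4 : GradientFRD.supNorm (y - c₀) ≤ (2 * h + 1 - 1) / 2 + (2 * h + 1 - 1) := by omega
      exact (supNorm_le_iff.1 h4) i
    -- every index is in `{−1, 0, 1}`
    have hidx : ∀ y' ∈ Y', ∀ i, |cubeIndex (2 * h + 1) y' i| ≤ 1 := by
      intro y' hy' i
      obtain ⟨y, hy, rfl⟩ := hmem y' hy'
      rw [cubeIndex_eq_resIndex]
      exact abs_resIndex_le_one_of_natAbs_le hsodd (hcoord y hy i)
    -- on no axis do both `1` and `−1` occur
    have hexcl : ∀ i, ∀ y' ∈ Y', ∀ z' ∈ Y', ¬ (cubeIndex (2 * h + 1) y' i = 1 ∧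
        cubeIndex (2 * h + 1) z' i = -1) := by
      intro i y' hy' z' hz' ⟨h1, h2⟩
      obtain ⟨y, hy, rfl⟩ := hmem y' hy'
      obtain ⟨z, hz, rfl⟩ := hmem z' hz'
      rw [cubeIndex_eq_resIndex] at h1 h2
      have hb1 := ((valMinAbs_bounds_of_resIndex_eq hsodd ((y - c₀) i)).1 h1)
      have hb2 := ((valMinAbs_bounds_of_resIndex_eq hsodd ((z - c₀) i)).2 h2)
      have e1 : (((2 * h + 1 : ℕ) : ℤ) + 1) / 2 = h + 1 := by push_cast; omega
      have e2 : (3 * ((2 * h + 1 : ℕ) : ℤ) - 1) / 2 = 3 * h + 1 := by push_cast; omega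
      rw [e1, e2] at hb1 hb2
      -- the difference `(y − z)_i` is small
      have hw := (supNorm_le_iff.1 (hY y hy z hz)) i
      set v := ((y - c₀) i).valMinAbs with hv
      set v' := ((z - c₀) i).valMinAbs with hv'
      set w := ((y - z) i).valMinAbs with hww
      have hwle : w ≤ 2 * (h : ℤ) := by omega
      have hwge : -(2 * (h : ℤ)) ≤ w := by omega
      -- `M ∣ v − v' − w`
      have hcast : (((v - v' - w : ℤ)) : ZMod M) = 0 := by
        have e3 : (y - c₀) i - (z - c₀) i = (y - z) i := by
          simp only [Pi.sub_apply]; ring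
        push_cast
        rw [hv, hv', hww, ZMod.coe_valMinAbs, ZMod.coe_valMinAbs, ZMod.coe_valMinAbs, e3, sub_self]
      rw [ZMod.intCast_zmod_eq_zero_iff_dvd, hM] at hcast
      obtain ⟨k, hk⟩ := hcast
      push_cast at hk
      have ht5' : (5 : ℤ) ≤ t := by exact_mod_cast ht5
      rcases le_or_gt k 0 with hk0 | hk0
      · have : (2 * (h : ℤ) + 1) * t * k ≤ 0 :=
          mul_nonpos_of_nonneg_of_nonpos (by positivity) hk0
        omega
      · have hk1 : (1 : ℤ) ≤ k := hk0
        have : (2 * (h : ℤ) + 1) * t * 1 ≤ (2 * (h : ℤ) + 1) * t * k :=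
          mul_le_mul_of_nonneg_left hk1 (by positivity)
        nlinarith
    -- count: the index vectors lie in a product of two-element sets
    set T : Fin d → Finset ℤ := fun i => Y'.image fun x => cubeIndex (2 * h + 1) x i with hT
    have hsub : (Y'.image fun x => fun i => cubeIndex (2 * h + 1) x i) ⊆ Fintype.piFinset T := by
      intro b hb
      obtain ⟨x, hx, rfl⟩ := mem_image.1 hb
      exact Fintype.mem_piFinset.2 fun i => mem_image.2 ⟨x, hx, rfl⟩
    have hTcard : ∀ i, (T i).card ≤ 2 := by
      intro i
      by_cases h1 : (1 : ℤ) ∈ T i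
      · -- then `−1 ∉ T i`, so `T i ⊆ {0, 1}`
        obtain ⟨y', hy', hy'1⟩ := mem_image.1 h1
        have hTs : T i ⊆ ({0, 1} : Finset ℤ) := by
          intro b hb
          obtain ⟨z', hz', rfl⟩ := mem_image.1 hb
          have hb1 := hidx z' hz' i
          rw [abs_le] at hb1
          have hne : cubeIndex (2 * h + 1) z' i ≠ -1 := fun hcon => hexcl i y' hy' z' hz' ⟨hy'1, hcon⟩
          rw [mem_insert, mem_singleton]
          omega
        exact (card_le_card hTs).trans card_le_two
      · have hTs : T i ⊆ ({-1, 0} : Finset ℤ) := by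
          intro b hb
          obtain ⟨z', hz', rfl⟩ := mem_image.1 hb
          have hb1 := hidx z' hz' i
          rw [abs_le] at hb1
          have hne : cubeIndex (2 * h + 1) z' i ≠ 1 := fun hcon => h1 (mem_image.2 ⟨z', hz', hcon⟩)
          rw [mem_insert, mem_singleton]
          omega
        exact (card_le_card hTs).trans card_le_two
    calc (Y'.image fun x => fun i => cubeIndex (2 * h + 1) x i).card
        ≤ (Fintype.piFinset T).card := card_le_card hsub
      _ = ∏ i, (T i).card := Fintype.card_piFinset T
      _ ≤ 2 ^ (univ : Finset (Fin d)).card := prod_le_pow_card _ _ _ fun i _ => hTcard i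
      _ = 2 ^ d := by rw [card_univ, Fintype.card_fin]


/-! ## Connected sub-polymers with a prescribed number of blocks -/

section Growth

variable [NeZero M]
open Literature.Barriers.CriticalPhenomena.LongRangePhi4.Polymer

omit [NeZero M] in
/-- First exit of a path from a set (path bookkeeping). [folklore] -/
private theorem exists_exit_step {α : Type*} {R : α → α → Prop} {S : Set α} {x y : α}
    (h : Relation.ReflTransGen R x y) (hx : x ∈ S) (hy : y ∉ S) :
    ∃ a c, R a c ∧ a ∈ S ∧ c ∉ S := by
  induction h with
  | refl => exact absurd hx hy
  | @tail b z _ hbz ih =>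
    by_cases hb : b ∈ S
    · exact ⟨b, z, hbz, hb, hy⟩
    · exact ih hb

omit [NeZero M] in
/-- The union of two connected sets joined by an `ℓ^∞`-edge is connected (elementary bookkeeping of
the `ℓ^∞`-connectedness of [AKM16] Ch. 4). [cite: AdamsKoteckyMuller2016, Ch. 4] -/
theorem isConn_union_of_adjInf {F G : Finset (Fin d → ZMod M)} (hF : IsConn F) (hG : IsConn G)
    {a c : Fin d → ZMod M} (ha : a ∈ F) (hc : c ∈ G) (hac : AdjInf a c) : IsConn (F ∪ G) := by
  refine ⟨⟨a, mem_union_left _ ha⟩, fun u hu v hv => ?_⟩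
  have hstep : ConnIn (F ∪ G) a c :=
    Relation.ReflTransGen.single ⟨mem_union_left _ ha, mem_union_right _ hc, hac⟩
  rcases mem_union.1 hu with hu | hu <;> rcases mem_union.1 hv with hv | hv
  · exact (hF.2 u hu v hv).mono subset_union_left
  · exact ((hF.2 u hu a ha).mono subset_union_left).trans
      (hstep.trans ((hG.2 c hc v hv).mono subset_union_right))
  · exact ((hG.2 u hu c hc).mono subset_union_right).trans
      (hstep.symm.trans ((hF.2 a ha v hv).mono subset_union_left))
  · exact (hG.2 u hu v hv).mono subset_union_right

/-- **Connected sub-polymers of every size**: inside a connected `k`-polymer `X` with at least `j ≥ 1`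
blocks, through every point there is a connected `k`-polymer `F ⊆ X` with exactly `j` blocks (grow
block by block along the `ℓ^∞`-edges leaving `F`; Brydges removes "a connected subset of `2^d + 1`
blocks"). [cite: Brydges2009, Lemma 6.15 (proof, induction step)] -/
theorem exists_isConn_subpolymer (hMo : Odd M) {s : ℕ} (hs : Odd s) {X : Finset (Fin d → ZMod M)}
    (hX : IsPolymer s X) (hc : IsConn X) {x : Fin d → ZMod M} (hx : x ∈ X) :
    ∀ j : ℕ, 1 ≤ j → j ≤ (blocks s X).card →
      ∃ F : Finset (Fin d → ZMod M), F ⊆ X ∧ x ∈ F ∧ IsPolymer s F ∧ IsConn F ∧ (blocks s F).card = j := by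
  intro j hj
  induction j, hj using Nat.le_induction with
  | base =>
    intro _
    exact ⟨blockOf s x, hX x hx, mem_blockOf_self s x, isPolymer_blockOf s x, isConn_blockOf hMo hs x,
      by rw [blocks_blockOf, card_singleton]⟩
  | succ j hj ih =>
    intro hjn
    obtain ⟨F, hFX, hxF, hFp, hFc, hFcard⟩ := ih (by omega)
    -- a point of `X` outside `F`
    have hXF : ¬ X ⊆ F := fun h' => by
      have : (blocks s X).card ≤ (blocks s F).card := card_le_card (blocks_mono s h')
      omega
    obtain ⟨c, hcX, hcF⟩ := exists_of_ssubset (ssubset_of_subset_not_subset hFX hXF)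
    -- first exit of an `X`-path from `x` to `c`
    obtain ⟨a, c', hac', haF, hc'F⟩ :=
      exists_exit_step (S := (↑F : Set (Fin d → ZMod M))) (hc.2 x hx c hcX) (mem_coe.2 hxF)
        (fun h => hcF (mem_coe.1 h))
    have hc'X : c' ∈ X := hac'.2.1
    have hc'F' : c' ∉ F := fun h => hc'F (mem_coe.2 h)
    refine ⟨F ∪ blockOf s c', union_subset hFX (hX c' hc'X), mem_union_left _ hxF,
      hFp.union (isPolymer_blockOf s c'),
      isConn_union_of_adjInf hFc (isConn_blockOf hMo hs c') (mem_coe.1 haF) (mem_blockOf_self s c') hac'.2.2,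
      ?_⟩
    have hnot : blockOf s c' ∉ blocks s F := by
      intro h
      obtain ⟨z, hz, hzc⟩ := mem_blocks.1 h
      exact hc'F' (hFp z hz (hzc ▸ mem_blockOf_self s c'))
    rw [blocks_union, blocks_blockOf, union_comm, ← insert_eq, card_insert_of_notMem hnot, hFcard]

end Growth

/-! ## Two blocks of a large connected polymer in a common coarse block -/

section Pair

variable [NeZero M]
open Literature.Barriers.CriticalPhenomena.LongRangePhi4.Polymer

/-- **Near every point of a large connected polymer there are two of its blocks in a common coarse
block** (`M = L·s·t`, odd sides, `t ≠ 3`, `L ≥ 2^d + 1`, `|X|_k > 2^d`): through `x ∈ X` grow a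
connected sub-polymer `F` with exactly `2^d + 1` blocks; it has sup-diameter `≤ (2^d+1)s − 1 < Ls`,
so it meets at most `2^d` blocks of side `Ls` (`card_blocks_le_two_pow_of_supNorm_sub_le`), and two of
its `2^d + 1` blocks lie in the same one.  (Brydges: "we only need to rule out the case
`|X|_j = |X̄|_{j+1} = 2^d + 1` … this contradiction proves the claim".)
[cite: Brydges2009, Lemma 6.15 (proof, first claim)] -/
theorem exists_pair_sameCoarseBlock_near {s L t : ℕ} (hM : M = L * s * t) (hs : Odd s) (hL : Odd L)
    (ht : Odd t) (ht3 : t ≠ 3) (hL2 : 2 ^ d + 1 ≤ L) {X : Finset (Fin d → ZMod M)} (hX : IsPolymer s X)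
    (hc : IsConn X) (hlarge : 2 ^ d < (blocks s X).card) {x : Fin d → ZMod M} (hx : x ∈ X) :
    ∃ y₁ ∈ X, ∃ y₂ ∈ X, blockOf s y₁ ≠ blockOf s y₂ ∧ blockOf (L * s) y₁ = blockOf (L * s) y₂ ∧
      GradientFRD.supNorm (x - y₁) + 1 ≤ (2 ^ d + 1) * s ∧
      GradientFRD.supNorm (x - y₂) + 1 ≤ (2 ^ d + 1) * s := by
  have hMo : Odd M := by rw [hM]; exact (hL.mul hs).mul ht
  -- the closure of a `k`-block is the `(k+1)`-block of its points (`GradientRG.closure_blockOf_mul`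
  -- of LinearisedMap, restated locally to keep this file free of the norm machinery)
  have hcl : ∀ y : Fin d → ZMod M, closure (L * s) (blockOf s y) = blockOf (L * s) y := fun y => by
    apply Subset.antisymm
    · exact closure_subset_of_isPolymer (blockOf_subset_blockOf_mul hs hL y) (isPolymer_blockOf _ y)
    · intro z hz
      exact mem_closure.2 ⟨y, mem_blockOf_self s y, mem_blockOf.1 hz⟩
  obtain ⟨F, hFX, hxF, hFp, hFc, hFcard⟩ :=
    exists_isConn_subpolymer hMo hs hX hc hx (2 ^ d + 1) (Nat.le_add_left 1 _) hlarge
  -- `F` has sup-diameter `≤ (2^d+1)s − 1 ≤ Ls − 1`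
  have hdiam : ∀ y ∈ F, ∀ y' ∈ F, GradientFRD.supNorm (y - y') ≤ L * s - 1 := by
    intro y hy y' hy'
    have h1 := supNorm_sub_lt_of_isConn hs hFc hFcard.le hy hy'
    have h2 : (2 ^ d + 1) * s ≤ L * s := Nat.mul_le_mul_right s hL2
    omega
  have hcoarse : (blocks (L * s) F).card ≤ 2 ^ d :=
    card_blocks_le_two_pow_of_supNorm_sub_le (by rw [hM]) (hL.mul hs) ht ht3 hdiam
  -- pigeonhole on `b ↦ closure b`
  have hlt : (blocks (L * s) F).card < (blocks s F).card := by omega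
  have hmaps : Set.MapsTo (fun b => closure (L * s) b) (blocks s F : Set (Finset (Fin d → ZMod M)))
      (blocks (L * s) F : Set (Finset (Fin d → ZMod M))) := by
    intro b hb
    obtain ⟨y, hy, rfl⟩ := mem_blocks.1 (mem_coe.1 hb)
    exact mem_coe.2 (mem_blocks.2 ⟨y, hy, (hcl y).symm⟩)
  obtain ⟨b₁, hb₁, b₂, hb₂, hne, heq⟩ := exists_ne_map_eq_of_card_lt_of_maps_to hlt hmaps
  obtain ⟨y₁, hy₁, rfl⟩ := mem_blocks.1 hb₁
  obtain ⟨y₂, hy₂, rfl⟩ := mem_blocks.1 hb₂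
  simp only [hcl] at heq
  exact ⟨y₁, hFX hy₁, y₂, hFX hy₂, hne, heq,
    supNorm_sub_lt_of_isConn hs hFc hFcard.le hxF hy₁,
    supNorm_sub_lt_of_isConn hs hFc hFcard.le hxF hy₂⟩

end Pair


/-! ## The closure gain for large connected polymers -/

section Gain

variable [NeZero M]
open Literature.Barriers.CriticalPhenomena.LongRangePhi4.Polymer

/-- **Closure gain, counted form** (`M = L·s·t`, odd sides, `t ≠ 3`, `L ≥ 2^d + 1`): for a connected
`k`-polymer `X` with more than `2^d` blocks, `|X̄|_{k+1} ≤ c(d)·(|X|_k − |X̄|_{k+1})` with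
`c(d) = (2(2^d+1) + 6)^d`, i.e. `|X|_k ≥ (1 + c(d)⁻¹)|X̄|_{k+1}` — Brydges' Lemma 6.15 with a
different constant.  Proof (a fibre count replacing the induction on components of the source):
choose in every `(k+1)`-block `B'` of `X̄` a representative `k`-block of `X`; near its point there are
two `k`-blocks of `X` in a common `(k+1)`-block (`exists_pair_sameCoarseBlock_near`), one of which is
not a representative; every non-representative block is so charged by at most `c(d)` coarse blocks
(their representatives lie in a cube of radius `(2^d+2)s` about it, `card_blocks_le_of_subset_ball`).
[cite: Brydges2009, Lemma 6.15] -/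
theorem card_blocks_closure_le_mul_sub {s L t : ℕ} (hM : M = L * s * t) (hs : Odd s) (hL : Odd L)
    (ht : Odd t) (ht3 : t ≠ 3) (hL2 : 2 ^ d + 1 ≤ L) {X : Finset (Fin d → ZMod M)} (hX : IsPolymer s X)
    (hc : IsConn X) (hlarge : 2 ^ d < (blocks s X).card) :
    (blocks (L * s) (closure (L * s) X)).card ≤
      (2 * (2 ^ d + 1) + 6) ^ d * ((blocks s X).card - (blocks (L * s) (closure (L * s) X)).card) := by
  set q := 2 ^ d + 1 with hq
  set 𝓑' := blocks (L * s) (closure (L * s) X) with h𝓑'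
  -- representatives
  have hrep : ∀ B' ∈ 𝓑', ∃ x ∈ X, blockOf (L * s) x = B' := by
    intro B' hB'
    obtain ⟨y, hy, rfl⟩ := mem_blocks.1 hB'
    obtain ⟨x, hx, hxy⟩ := mem_closure.1 hy
    exact ⟨x, hx, blockOf_eq_of_mem (mem_blockOf.2 hxy.symm)⟩
  choose! xr hxrX hxrB using hrep
  -- a representative block determines its coarse block
  have key : ∀ B' ∈ 𝓑', ∀ y : Fin d → ZMod M, blockOf s (xr B') = blockOf s y → B' = blockOf (L * s) y := by
    intro B' hB' y heq
    have h1 : xr B' ∈ blockOf s y := heq ▸ mem_blockOf_self s (xr B')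
    have h2 := blockOf_eq_of_mem (blockOf_subset_blockOf_mul hs hL y h1)
    rw [hxrB B' hB'] at h2
    exact h2
  have hinj : Set.InjOn (fun B' => blockOf s (xr B')) (𝓑' : Set (Finset (Fin d → ZMod M))) := by
    intro B₁ hB₁ B₂ hB₂ heq
    have := key B₁ (mem_coe.1 hB₁) (xr B₂) heq
    rw [hxrB B₂ (mem_coe.1 hB₂)] at this
    exact this
  have hinjx : Set.InjOn xr (𝓑' : Set (Finset (Fin d → ZMod M))) := by
    intro B₁ hB₁ B₂ hB₂ heq
    exact hinj hB₁ hB₂ (by simp only [heq])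
  set Rep := 𝓑'.image (fun B' => blockOf s (xr B')) with hRep
  have hRepSub : Rep ⊆ blocks s X := by
    intro b hb
    obtain ⟨B', hB', rfl⟩ := mem_image.1 hb
    exact mem_blocks.2 ⟨xr B', hxrX B' hB', rfl⟩
  have hRepCard : Rep.card = 𝓑'.card := card_image_of_injOn hinj
  -- witnesses: a non-representative block of `X` near the representative point
  have hW : ∀ B' ∈ 𝓑', ∃ b ∈ blocks s X \ Rep, ∃ w ∈ X, blockOf s w = b ∧
      GradientFRD.supNorm (xr B' - w) + 1 ≤ q * s := by
    intro B' hB'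
    obtain ⟨y₁, hy₁, y₂, hy₂, hne, hsame, hd₁, hd₂⟩ :=
      exists_pair_sameCoarseBlock_near hM hs hL ht ht3 hL2 hX hc hlarge (hxrX B' hB')
    by_cases h1 : blockOf s y₁ ∈ Rep
    · refine ⟨blockOf s y₂, mem_sdiff.2 ⟨mem_blocks.2 ⟨y₂, hy₂, rfl⟩, fun h2 => hne ?_⟩, y₂, hy₂, rfl, hd₂⟩
      obtain ⟨B₁, hB₁, hB₁eq⟩ := mem_image.1 h1
      obtain ⟨B₂, hB₂, hB₂eq⟩ := mem_image.1 h2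
      have e1 := key B₁ hB₁ y₁ hB₁eq
      have e2 := key B₂ hB₂ y₂ hB₂eq
      rw [← hsame, ← e1] at e2
      rw [← hB₁eq, ← hB₂eq, e2]
    · exact ⟨blockOf s y₁, mem_sdiff.2 ⟨mem_blocks.2 ⟨y₁, hy₁, rfl⟩, h1⟩, y₁, hy₁, rfl, hd₁⟩
  choose! W hWmem w hwX hwb hwd using hW
  -- fibres of `W` have at most `c(d)` elements
  have hM' : M = s * (L * t) := by rw [hM]; ring
  have hfib : ∀ b ∈ 𝓑'.image W, (𝓑'.filter fun B' => W B' = b).card ≤ (2 * (2 ^ d + 1) + 6) ^ d := by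
    intro b hb
    set Fb := 𝓑'.filter fun B' => W B' = b with hFb
    obtain ⟨B₀, hB₀, hB₀b⟩ := mem_image.1 hb
    have hB₀' : B₀ ∈ 𝓑' := hB₀
    -- all representative points of the fibre lie within `q s + s` of `w B₀`
    set P := Fb.image xr with hP
    have hnear : ∀ p ∈ P, GradientFRD.supNorm (p - w B₀) ≤ q * s + s := by
      intro p hp
      obtain ⟨B', hB', rfl⟩ := mem_image.1 hp
      obtain ⟨hB'𝓑, hB'b⟩ := mem_filter.1 hB'
      have h1 := hwd B' hB'𝓑
      have h2 : SameBlock s (w B') (w B₀) := by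
        have e : blockOf s (w B') = blockOf s (w B₀) := by rw [hwb B' hB'𝓑, hwb B₀ hB₀', hB'b, hB₀b]
        exact mem_blockOf.1 (e ▸ mem_blockOf_self s (w B₀))
      have h3 := supNorm_sub_le_of_sameBlock hs h2
      have h4 := supNorm_sub_le (xr B') (w B') (w B₀)
      omega
    have hPblocks : (blocks s P).card ≤ (2 * ((q * s + s) / s) + 4) ^ d :=
      card_blocks_le_of_subset_ball hM' hs (hL.mul ht) hnear
    have hdiv : (q * s + s) / s = q + 1 := by
      rw [show q * s + s = (q + 1) * s by ring]
      exact Nat.mul_div_cancel _ hs.pos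
    rw [hdiv, show 2 * (q + 1) + 4 = 2 * (2 ^ d + 1) + 6 by rw [hq]; ring] at hPblocks
    -- `Fb ≃ P ≃ blocks s P`
    have hFbsub : (Fb : Set (Finset (Fin d → ZMod M))) ⊆ 𝓑' := by
      intro B' hB'; exact mem_coe.2 (mem_filter.1 (mem_coe.1 hB')).1
    have hFbP : Fb.card = P.card := (card_image_of_injOn (hinjx.mono hFbsub)).symm
    have hPb : P.card = (blocks s P).card := by
      rw [blocks]
      refine (card_image_of_injOn ?_).symm
      intro p₁ hp₁ p₂ hp₂ heq
      obtain ⟨B₁, hB₁, rfl⟩ := mem_image.1 (mem_coe.1 hp₁)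
      obtain ⟨B₂, hB₂, rfl⟩ := mem_image.1 (mem_coe.1 hp₂)
      have := hinj (hFbsub (mem_coe.2 hB₁)) (hFbsub (mem_coe.2 hB₂)) heq
      rw [this]
    rw [hFbP, hPb]
    exact hPblocks
  -- count
  have himg : 𝓑'.image W ⊆ blocks s X \ Rep := by
    intro b hb
    obtain ⟨B', hB', rfl⟩ := mem_image.1 hb
    exact hWmem B' hB'
  have h1 := card_le_mul_card_image 𝓑' _ hfib
  have h2 : (𝓑'.image W).card ≤ (blocks s X).card - 𝓑'.card := by
    rw [← hRepCard, ← card_sdiff_of_subset hRepSub]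
    exact card_le_card himg
  exact h1.trans (Nat.mul_le_mul_left _ h2)

/-- **Brydges' closure gain on the torus** `M = L·s·t` (`s, L, t` odd, `t ≠ 3`, `L ≥ 2^d + 1`):
`η·|X̄|_{k+1} ≤ |X|_k` with `η = 1 + (2(2^d+1)+6)^{−d} > 1` for every connected `k`-polymer `X` with
more than `2^d` blocks (`s = L^k`, `X̄` = closure at side `L s`).  The named fact
`TorusPolymer.BrydgesClosureGain d` (PolymerClosureGain) quantifies also over `t = 3`, where three
coarse blocks along an axis are pairwise cyclic neighbours; the renormalisation-group tori
`M = L^N` have `t = L^{N−k−1} ∈ {1} ∪ [L, ∞)`, covered here.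
[cite: Brydges2009, Lemma 6.15] -/
theorem closureGain {s L t : ℕ} (hM : M = L * s * t) (hs : Odd s) (hL : Odd L) (ht : Odd t)
    (ht3 : t ≠ 3) (hL2 : 2 ^ d + 1 ≤ L) {X : Finset (Fin d → ZMod M)} (hX : IsPolymer s X)
    (hc : IsConn X) (hlarge : 2 ^ d < (blocks s X).card) :
    (1 + 1 / ((2 * (2 ^ d + 1) + 6 : ℝ) ^ d)) * ((blocks (L * s) (closure (L * s) X)).card : ℝ) ≤
      ((blocks s X).card : ℝ) := by
  have h := card_blocks_closure_le_mul_sub hM hs hL ht ht3 hL2 hX hc hlarge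
  have hmn : (blocks (L * s) (closure (L * s) X)).card ≤ (blocks s X).card :=
    card_blocks_closure_le hs hL X
  set m := (blocks (L * s) (closure (L * s) X)).card
  set n := (blocks s X).card
  set c : ℕ := (2 * (2 ^ d + 1) + 6) ^ d with hc'
  have hc0 : (0 : ℝ) < c := by positivity
  have h' : (m : ℝ) ≤ (c : ℝ) * ((n : ℝ) - m) := by
    have : ((m : ℕ) : ℝ) ≤ ((c * (n - m) : ℕ) : ℝ) := by exact_mod_cast h
    rw [Nat.cast_mul, Nat.cast_sub hmn] at this
    exact this
  have hcR : ((2 * (2 ^ d + 1) + 6 : ℝ) ^ d) = (c : ℝ) := by rw [hc']; push_cast; ring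
  rw [hcR, add_mul, one_mul, div_mul_eq_mul_div, one_mul]
  have : (m : ℝ) / c ≤ n - m := by rw [div_le_iff₀ hc0]; linarith
  linarith

/-- **The closure gain in the shape consumed by the contraction estimate** (hypothesis `hgain` of
`LinearisedMapABKMContraction.weakNormLE_opC_abkm` and of [ABKM19] Lemma 9.6/10.2): one `η > 1`
for all renormalisation-group tori `M = L^N`, `L` odd, `L ≥ 2^d + 1`, `L ≥ 5`, all scales `k + 1 ≤ N`.
[cite: Brydges2009, Lemma 6.15] -/
theorem exists_closureGain_pow (d : ℕ) :
    ∃ η : ℝ, 1 < η ∧ ∀ (L N : ℕ) (M : ℕ) [NeZero M], Odd L → 2 ^ d + 1 ≤ L → 5 ≤ L → M = L ^ N →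
      ∀ k : ℕ, k + 1 ≤ N → ∀ X : Finset (Fin d → ZMod M), IsPolymer (L ^ k) X → IsConn X →
        2 ^ d < (blocks (L ^ k) X).card →
          η * ((blocks (L * L ^ k) (closure (L * L ^ k) X)).card : ℝ) ≤ (blocks (L ^ k) X).card := by
  refine ⟨1 + 1 / ((2 * (2 ^ d + 1) + 6 : ℝ) ^ d), lt_add_of_pos_right 1 (by positivity), ?_⟩
  intro L N M _ hL hL2 hL5 hM k hk X hX hc hlarge
  have hMeq : M = L * L ^ k * L ^ (N - k - 1) := by
    rw [hM, ← pow_succ', ← pow_add]; congr 1; omega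
  have ht3 : L ^ (N - k - 1) ≠ 3 := by
    rcases Nat.eq_zero_or_pos (N - k - 1) with h0 | h0
    · rw [h0, pow_zero]; norm_num
    · intro h3
      have : L ≤ L ^ (N - k - 1) := Nat.le_self_pow (by omega) L
      omega
  exact closureGain hMeq (hL.pow) hL (hL.pow) ht3 hL2 hX hc hlarge

end Gain

end Literature.MathematicalPhysics.StatisticalMechanics.TorusPolymer

end
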